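import Summits.QuantumFields.YangMills.Theorems.ColdStartUniversalityLatticeLangevinDoeblinBetaZero
import Summits.QuantumFields.YangMills.Theorems.ColdStartUniversalityLatticeLangevinInvariantOfKernel
import HarnessLib

/-!
# Route `ColdStartUniversality`, crux K_A1 `UniformColdStartMixing` (stmt-QuantumFields-24809), rung `stub_fixedCutoffMixing`:
# SZZ Lemma 3.3 at `β' = 0` — the Haar measure of `SU(2)^E` is invariant under the `β' = 0` lattice Langevin dynamics

Helper file (seat `ym-line-csu-p1`, g7).  The named fact `WilsonMeasureLangevinInvariant (fundamentalLatticeRep 2) 3 L β'`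
(SZZ Lemma 3.3) is DISCHARGED here at `β' = 0` (`wilsonMeasureLangevinInvariant_beta_zero`), where the Wilson measure is the
product Haar measure (`wilsonMeasure_zero_eq_pi`) and the dynamics is Brownian motion on `SU(2)^E`: the transition kernels
(`exists_transitionKernel`) act diagonally on the latitude eigenfunctions (`integral_prod_gegenbauer_latitude`), whose
Haar integrals vanish except for the constant one (`integral_prod_gegenbauer_latitude_pi_haar`), so `κ⁰_t ∘ₘ Haar^{⊗E}` and
`Haar^{⊗E}` have the same ridge moments and are equal by `measure_eq_of_forall_integral_prod_gegenbauer_eq`; the socket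
`wilsonMeasureLangevinInvariant_of_kernelInvariant` (g5) concludes.  This is the `β' = 0` instance of the I-block of the g7 plan
(`Cruxes/UniformColdStartMixing/Lines/rung_fixedCutoffMixing.md`); `β' > 0` needs the discrete-Girsanov E-block.  No definition,
no sorry.  RECORD-rung R3 plumbing; nothing here bears on the mass gap.
-/

set_option autoImplicit false

noncomputable section

namespace Summit.QuantumFields.YangMills.Theorems.ColdStartUniversality

open MeasureTheory Finset ProbabilityTheory
open scoped BigOperators NNReal ENNReal
open Literature.MathematicalPhysics.QuantumFieldTheory
open Literature.MathematicalPhysics.QuantumFieldTheory.Tomboulis2007 (su2Char)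
open Literature.MathematicalPhysics.QuantumLattice (fundamentalRep fundamentalLatticeRep continuous_fundamentalRep)
open Literature.Analysis.SpecialFunctions (gegenbauerSum)
open Literature.Probability.Process

variable {L : ℕ} [NeZero L]

/-- At `β = 0` the Wilson measure of `SU(2)` lattice gauge theory is the product Haar probability measure. [folklore] -/
theorem wilsonMeasure_zero_eq_pi :
    wilsonMeasure (d := 3) (L := L) (fundamentalRep (Fin 2)) 0 =
      Measure.pi fun _ : Edge 3 L => haarProbability (Matrix.specialUnitaryGroup (Fin 2) ℂ) := by
  haveI : IsProbabilityMeasure (haarProbability (Matrix.specialUnitaryGroup (Fin 2) ℂ)) := inferInstance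
  have hw : wilsonWeight (d := 3) (L := L) (fundamentalRep (Fin 2)) 0 =
      Measure.pi fun _ : Edge 3 L => haarProbability (Matrix.specialUnitaryGroup (Fin 2) ℂ) := by
    unfold wilsonWeight
    have h1 : (fun U : GaugeConfig 3 L (Matrix.specialUnitaryGroup (Fin 2) ℂ) =>
        ENNReal.ofReal (Real.exp (-0 * wilsonAction (fundamentalRep (Fin 2)) U))) = 1 := by
      funext U; simp
    rw [h1, withDensity_one]
  unfold wilsonMeasure partitionFunction
  rw [hw, measure_univ, inv_one, one_smul]

/-- **Haar integrals of the latitude eigenfunctions**: `∫ ∏_e U_{m_e}(⟨ρ g_e, ρ y_e⟩) dHaar^{⊗E}(y) = [m = 0]`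
(character orthonormality `∫ χ_m χ_0 dHaar = δ_{m0}` edge by edge, right invariance of Haar). [folklore] -/
theorem integral_prod_gegenbauer_latitude_pi_haar (g : Edge 3 L → Matrix.specialUnitaryGroup (Fin 2) ℂ) (m : Edge 3 L → ℕ) :
    ∫ y, ∏ e, gegenbauerSum 1 (m e) (hsForm 2 (fundamentalRep (Fin 2) (g e)) (fundamentalRep (Fin 2) (y e)) / 2)
      ∂(Measure.pi fun _ : Edge 3 L => haarProbability (Matrix.specialUnitaryGroup (Fin 2) ℂ)) =
      if m = 0 then 1 else 0 := by
  classical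
  haveI : IsProbabilityMeasure (haarProbability (Matrix.specialUnitaryGroup (Fin 2) ℂ)) := inferInstance
  haveI := YM2.isMulRightInvariant_haarProbability (Matrix.specialUnitaryGroup (Fin 2) ℂ)
  rw [integral_fintype_prod_eq_prod (𝕜 := ℝ)
    (f := fun e (x : Matrix.specialUnitaryGroup (Fin 2) ℂ) =>
      gegenbauerSum 1 (m e) (hsForm 2 (fundamentalRep (Fin 2) (g e)) (fundamentalRep (Fin 2) x) / 2))]
  have hedge : ∀ e, ∫ x, gegenbauerSum 1 (m e) (hsForm 2 (fundamentalRep (Fin 2) (g e)) (fundamentalRep (Fin 2) x) / 2)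
      ∂(haarProbability (Matrix.specialUnitaryGroup (Fin 2) ℂ)) = if m e = 0 then 1 else 0 := by
    intro e
    simp_rw [← su2Char_mul_inv_eq_gegenbauerSum]
    rw [integral_mul_right_eq_self (fun x => su2Char (m e) x) (g e)⁻¹]
    have h := Tomboulis2007.integral_su2Char_mul_su2Char (m e) 0
    simp_rw [su2Char_zero_apply, mul_one] at h
    exact h
  simp_rw [hedge]
  by_cases hm : m = 0
  · subst hm; simp
  · rw [if_neg hm]
    obtain ⟨e, he⟩ := Function.ne_iff.1 hm
    exact Finset.prod_eq_zero (Finset.mem_univ e) (if_neg he)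

/-- **SZZ Lemma 3.3 at `β' = 0`: the (Haar) Wilson measure is invariant under the `SU(2)` lattice Langevin dynamics at
`β' = 0`** — the named fact `WilsonMeasureLangevinInvariant (fundamentalLatticeRep 2) 3 L 0` is a theorem.
[cite: ShenZhuZhu2022, §3 Lemma 3.3 (invariance of the lattice Yang–Mills measure; p. 13)] -/
theorem wilsonMeasureLangevinInvariant_beta_zero (L : ℕ) [NeZero L] :
    WilsonMeasureLangevinInvariant (fundamentalLatticeRep 2) 3 L 0 := by
  classical
  haveI := secondCountableTopology_su2
  haveI := borelSpace_config L
  haveI : IsProbabilityMeasure (haarProbability (Matrix.specialUnitaryGroup (Fin 2) ℂ)) := inferInstance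
  obtain ⟨κ, hκ, -, hreal⟩ := exists_transitionKernel L 0
  haveI := hκ
  refine wilsonMeasureLangevinInvariant_of_kernelInvariant L 0 κ hreal fun t => ?_
  rw [wilsonMeasure_zero_eq_pi]
  set H : Measure (GaugeConfig 3 L (Matrix.specialUnitaryGroup (Fin 2) ℂ)) :=
    Measure.pi fun _ : Edge 3 L => haarProbability (Matrix.specialUnitaryGroup (Fin 2) ℂ) with hH
  haveI : IsProbabilityMeasure H := by rw [hH]; infer_instance
  haveI : IsProbabilityMeasure ((κ t) ∘ₘ H) := by infer_instance
  -- the regular flow on the product Wiener space realises `κ t`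
  haveI := isProbabilityMeasure_piWiener (Edge 3 L × NoiseIdx 2)
  have hWc := isFlatBrownian_piWiener 3 L (NoiseIdx 2)
  obtain ⟨Uc, G, hUc, hUm, -, -, -⟩ := exists_regularFlow L 0 hWc
  have hκU : ∀ x, κ t x = (Measure.pi fun _ : Edge 3 L × NoiseIdx 2 => preWienerMeasure).map (Uc x t) := fun x =>
    hreal t x _ _ _ hWc (Uc x) (hUc x).1 (hUc x).2
  have hmU : ∀ x, Measurable (Uc x t) := fun x => ((hUc x).2.adapted t).mono (hWc.natFiltration.le t) le_rfl
  -- compare ridge moments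
  change (κ t) ∘ₘ H = H
  refine measure_eq_of_forall_integral_prod_gegenbauer_eq (L := L) fun g m => ?_
  have hcontF : Continuous fun y : GaugeConfig 3 L (Matrix.specialUnitaryGroup (Fin 2) ℂ) =>
      ∏ e, gegenbauerSum 1 (m e) (hsForm 2 (fundamentalRep (Fin 2) (g e)) (fundamentalRep (Fin 2) (y e)) / 2) :=
    continuous_prod_gegenbauer_latitude g m
  obtain ⟨M, -, hM⟩ := exists_abs_le_of_continuous hcontF
  have hfi : Integrable (fun y => ∏ e, gegenbauerSum 1 (m e)
      (hsForm 2 (fundamentalRep (Fin 2) (g e)) (fundamentalRep (Fin 2) (y e)) / 2)) ((κ t) ∘ₘ H) :=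
    Integrable.of_bound hcontF.measurable.aestronglyMeasurable M (Filter.Eventually.of_forall fun y => by
      rw [Real.norm_eq_abs]; exact hM y)
  have hcomp : ∫ y, ∏ e, gegenbauerSum 1 (m e) (hsForm 2 (fundamentalRep (Fin 2) (g e)) (fundamentalRep (Fin 2) (y e)) / 2)
      ∂((κ t) ∘ₘ H) = ∫ x, ∫ y, ∏ e, gegenbauerSum 1 (m e)
        (hsForm 2 (fundamentalRep (Fin 2) (g e)) (fundamentalRep (Fin 2) (y e)) / 2) ∂(κ t x) ∂H := by
    rw [Measure.comp_eq_comp_const_apply] at hfi ⊢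
    rw [Kernel.integral_comp hfi, Kernel.const_apply]
  rw [hcomp]
  have hinner : ∀ x, ∫ y, ∏ e, gegenbauerSum 1 (m e)
      (hsForm 2 (fundamentalRep (Fin 2) (g e)) (fundamentalRep (Fin 2) (y e)) / 2) ∂(κ t x) =
      Real.exp (-(∑ e, (m e : ℝ) * ((m e : ℝ) + 2) / 2) * t) *
        ∏ e, gegenbauerSum 1 (m e) (hsForm 2 (fundamentalRep (Fin 2) (g e)) (fundamentalRep (Fin 2) (x e)) / 2) := by
    intro x
    rw [hκU x, integral_map (hmU x).aemeasurable hcontF.aestronglyMeasurable]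
    exact integral_prod_gegenbauer_latitude hWc Uc hUc hUm x g m t
  simp_rw [hinner]
  rw [integral_const_mul, hH, integral_prod_gegenbauer_latitude_pi_haar g m]
  by_cases hm : m = 0
  · subst hm; simp
  · rw [if_neg hm, mul_zero]

end Summit.QuantumFields.YangMills.Theorems.ColdStartUniversality

end
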